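import Summits.BirchSwinnertonDyer.BirchSwinnertonDyer.Theorems.GoldfeldAllTwistsTwoConverseTwinAdditiveTwoPrimesTwistHalvability
import Summits.BirchSwinnertonDyer.BirchSwinnertonDyer.Theorems.GoldfeldAllTwistsTwoConverseTwinAdditiveTwoPrimesTwistSelmerDualPOne
import HarnessLib

set_option linter.dupNamespace false -- namespace `…BirchSwinnertonDyer.BirchSwinnertonDyer…` is the cell's (D-0017 nested layout)
set_option autoImplicit false

/-!
# Twin″ (item 19140), cell C7, TRANCHE C7-3 file F12a: the HALVABILITY VALUE is `k = 1` for `49a1^{(−2qp)}` over `K = ℚ(√−2qp)` on C7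
# — fact-free given rank one, by a TWO-SIDED square-class count

Cell `bsd-goldfeld`, seat `bsd-goldfeld-s1p-c3x` (gen 12); planner RULING (cccxxxviii) (3) «TRANCHE C7-3 (formula axis)», first input of F12
(the `BSD(W,2)` closer). `--supports stmt-BirchSwinnertonDyer-19140` as a HELPER. FACT-FREE: no print binder, no definition, no `sorry`.

WHY A NEW ARGUMENT. T3-I-a (`not_forall_halvable_twoPrimesTwist`, cells C4 ∪ C6 ∪ C8) decided `k = 1` from `#α(E(ℚ)) ≤ #S ≤ 2` and «no class
of `S′` is divisible by `p`»; on C7 BOTH inputs are false (`#S = 4`, and `−qp, 7qp ∈ S′`, files F9a/F9b). The repair: bound BOTH images under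
the halving hypothesis. If every `y ∈ E(ℚ)` is `2Q + torsion` in `E(K)`, then
* (E-side, §1, new) `α_K(ι y) ∈ {1, [b]_K}` (`α_K` kills `2E(K)`; an odd multiple of the torsion part is `O` or `T`), so `α(y)` is one of the
  four rational classes `1, [b], [d_K], [b d_K]` (`xSqClass_cases_of_xSqClass_incl`); on C7 `[d_K] = [−2qp]`, `[b d_K] = [−14qp]` are not in
  `S ⊆ {1, 2, 7, 14}` ⇒ `#α(E(ℚ)) ≤ 2`;
* (E′-side, T3-I-a core `xSqClass_codomain_mem_pair_of_forall_halvable`) `α′(E′(ℚ)) ⊆ {1, [a′₄]}` once `[d_K] = [−2qp]`, `[a′₄ d_K] = [14qp]` are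
  excluded — on C7 they are not in `S′ ⊆ {1, −7, −qp, 7qp}` ⇒ `#α′(E′(ℚ)) ≤ 2`;
and `#α·#α′ = 2^{rank+2} = 8` is contradicted (`not_forall_halvable_of_descent`). So **on C7, for `K` imaginary quadratic with `d_K = −8qp` and
ANY elliptic `W` with `C • W = X₀(49)^{(−2qp)}` of rank one, NOT every `y ∈ W(ℚ)` is halvable in `W(K)` up to torsion** (`k = 1`; kit
j312848/j313281 column `lev = 1` on 70/70 rows). Which of `(#α, #α′) = (2,4), (4,2)` holds is NOT decided here (F11: `Ш(W)[2] = 0` forces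
`Ш(E)[φ] = 0`, hence `#α′ = #S′`).
HONEST FRAMING: Mordell–Weil algebra; nothing about `L`-values; no `BSD(W,2)` is proved; BSD is not proved by any of this; item 19140 stays open.

References: [SilvermanTate2015] §3.4–3.6; [SilvermanAEC2009] III.4.5, X.4.9, Exercise 10.16.
-/

noncomputable section

open scoped Classical

open WeierstrassCurve Literature.NumberTheory.EllipticCurves Literature.NumberTheory.EllipticCurves.ModularForms
  WeierstrassCurve.QuadraticDescent
open WeierstrassCurve.Affine (sqClass sqClass_mul sqClass_eq_one_iff)

namespace Summit.BirchSwinnertonDyer.BirchSwinnertonDyer.Theorems.GoldfeldGoodTwists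

/-! ## §1 The E-side obstruction and the two-sided count (any `E : y² = x³ + ax² + bx` over `ℚ`, `K` imaginary quadratic) -/

section TwoSided

variable {K : Type} [Field K] [NumberField K]

/-- **The E-side obstruction.** `E : y² = x³ + ax² + bx` over `ℚ`, `K` a number field with `a² − 4b, b ∉ K²`, `y ∈ E(ℚ)`: if `ι y = 2Q + t` in
`E(K)` with `t` torsion then `α_K(ι y) ∈ {1, [b]_K}` — `α_K` is a homomorphism killing `2E(K)`, and an odd multiple of `t` is `O` or `T`
(`exists_odd_nsmul_mem_pair`, `xSqClass_zsmul_of_odd`). [cite: SilvermanTate2015, §3.5 Prop. 3.8] [cite: SilvermanAEC2009, Exercise 10.16] -/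
theorem xSqClass_incl_of_halvable (E : WeierstrassCurve ℚ) [E.IsTwoTorsionNF] [E.IsElliptic]
    (hD : ¬ IsSquare ((E.baseChange K).a₂ ^ 2 - 4 * (E.baseChange K).a₄)) (hb : ¬ IsSquare (E.baseChange K).a₄)
    (y : E.toAffine.Point) (Q : (E.baseChange K).toAffine.Point) (ht : IsOfFinAddOrder (incl K E y - (2 : ℤ) • Q)) :
    (E.baseChange K).xSqClass (incl K E y) = 1 ∨ (E.baseChange K).xSqClass (incl K E y) = sqClass (E.baseChange K).a₄ := by
  haveI : (E.baseChange K).IsElliptic := by rw [WeierstrassCurve.baseChange]; infer_instance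
  obtain ⟨m, hm, hmt⟩ := (E.baseChange K).exists_odd_nsmul_mem_pair hD hb ht
  have hmZ : Odd (m : ℤ) := by exact_mod_cast hm
  have e : (m : ℤ) • incl K E y = ((m : ℤ) • Q + (m : ℤ) • Q) + (m : ℤ) • (incl K E y - (2 : ℤ) • Q) := by
    rw [smul_sub, two_zsmul, smul_add]; abel
  have hα := congrArg (E.baseChange K).xSqClass e
  rw [xSqClass_zsmul_of_odd _ hmZ, xSqClass_add, xSqClass_add, Affine.SqUnits.mul_self, Affine.SqUnits.one_mul] at hα
  rw [← natCast_zsmul] at hmt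
  rcases hmt with h0 | hT
  · left; rw [hα, h0, xSqClass_zero]
  · right; rw [hα, hT, xSqClass_twoTorsionPoint]

/-- **E-side count.** Under «every `y ∈ E(ℚ)` is halvable in `E(K)` up to torsion», with the classes `[d_K]`, `[b d_K]` excluded from `α(E(ℚ))`:
`α(E(ℚ)) ⊆ {1, [b]}`, so `#α(E(ℚ)) ≤ 2` (`xSqClass_cases_of_xSqClass_incl`). [cite: SilvermanTate2015, §3.5–3.6] -/
theorem natCard_range_xSqClass_le_two_of_forall_halvable (hK : IsImaginaryQuadratic K) (E : WeierstrassCurve ℚ)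
    [E.IsTwoTorsionNF] [E.IsElliptic]
    (hD : ¬ IsSquare ((E.baseChange K).a₂ ^ 2 - 4 * (E.baseChange K).a₄)) (hb : ¬ IsSquare (E.baseChange K).a₄)
    (hne : ∀ P : E.toAffine.Point,
      E.xSqClass P ≠ sqClass ((NumberField.discr K : ℤ) : ℚ) ∧ E.xSqClass P ≠ sqClass (E.a₄ * ((NumberField.discr K : ℤ) : ℚ)))
    (hall : ∀ y : E.toAffine.Point, ∃ Q : (E.baseChange K).toAffine.Point,
      incl K E y - (2 : ℤ) • Q ∈ AddCommGroup.torsion (E.baseChange K).toAffine.Point) :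
    Nat.card (Set.range E.xSqClass) ≤ 2 := by
  have hsub : Set.range E.xSqClass ⊆ ↑({1, sqClass E.a₄} : Finset (Affine.SqUnits ℚ)) := by
    rintro c ⟨y, rfl⟩
    rw [Finset.coe_insert, Finset.coe_singleton]
    obtain ⟨Q, hQ⟩ := hall y
    rcases xSqClass_cases_of_xSqClass_incl hK E y
        (xSqClass_incl_of_halvable E hD hb y Q ((AddCommGroup.mem_torsion _).mp hQ)) with h | h | h | h
    · exact Or.inl h
    · exact Or.inr h
    · exact absurd h (hne y).1
    · exact absurd h (hne y).2
  calc Nat.card (Set.range E.xSqClass)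
      ≤ Nat.card (↑({1, sqClass E.a₄} : Finset (Affine.SqUnits ℚ)) : Set (Affine.SqUnits ℚ)) :=
        Nat.card_mono (Finset.finite_toSet _) hsub
    _ = ({1, sqClass E.a₄} : Finset (Affine.SqUnits ℚ)).card := by rw [Nat.card_coe_set_eq, Set.ncard_coe_finset]
    _ ≤ 2 := Finset.card_le_two

/-- **The two-sided count.** With `[d_K]`, `[b d_K]` excluded from `α(E(ℚ))` AND `[d_K]`, `[a′₄ d_K]` excluded from `α′(E′(ℚ))`, in rank one NOT every
`y ∈ E(ℚ)` is halvable in `E(K)` up to torsion: otherwise `#α ≤ 2` (E-side) and `#α′ ≤ 2` (T3-I-a core), against `#α·#α′ = 8`.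
[cite: SilvermanTate2015, §3.6] [cite: SilvermanAEC2009, Prop. X.4.9] -/
theorem not_forall_halvable_of_descent_twoSided (hK : IsImaginaryQuadratic K) (E : WeierstrassCurve ℚ) [E.IsTwoTorsionNF] [E.IsElliptic]
    (hD : ¬ IsSquare ((E.baseChange K).a₂ ^ 2 - 4 * (E.baseChange K).a₄)) (hb : ¬ IsSquare (E.baseChange K).a₄)
    (hne : ∀ P : E.toAffine.Point,
      E.xSqClass P ≠ sqClass ((NumberField.discr K : ℤ) : ℚ) ∧ E.xSqClass P ≠ sqClass (E.a₄ * ((NumberField.discr K : ℤ) : ℚ)))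
    (hne' : ∀ P : E.twoIsogenyCodomain.toAffine.Point,
      E.twoIsogenyCodomain.xSqClass P ≠ sqClass ((NumberField.discr K : ℤ) : ℚ) ∧
        E.twoIsogenyCodomain.xSqClass P ≠ sqClass (E.twoIsogenyCodomain.a₄ * ((NumberField.discr K : ℤ) : ℚ)))
    (hr : E.mordellWeilRank = 1) :
    ¬ ∀ y : E.toAffine.Point, ∃ Q : (E.baseChange K).toAffine.Point,
        incl K E y - (2 : ℤ) • Q ∈ AddCommGroup.torsion (E.baseChange K).toAffine.Point := fun hall ↦
  not_forall_halvable_of_descent hK E hD hb hne' (natCard_range_xSqClass_le_two_of_forall_halvable hK E hD hb hne hall) hr hall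

end TwoSided

/-! ## §2 Cell C7: `E = ⟨0, −42qp, 0, 448q²p², 0⟩`, `E′ = ⟨0, 84qp, 0, −28q²p², 0⟩`, `K = ℚ(√−2qp)` -/

section HalvabilityC7

variable {K : Type} [Field K] [NumberField K] {q p : ℕ} [Fact q.Prime] [Fact p.Prime]

omit [Field K] [NumberField K] in
/-- Squarefree integers with the same square class in `ℚ^×/ℚ^{×2}` are equal (tree `eq_of_squarefree_of_mul_eq_sq`). [folklore] -/
private theorem eq_of_squarefree_of_sqClass_intCast_eq_pOne {d₁ d₂ : ℤ} (h₁ : Squarefree d₁) (h₂ : Squarefree d₂)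
    (he : sqClass (d₁ : ℚ) = sqClass (d₂ : ℚ)) : d₁ = d₂ := by
  have h0₁ : (d₁ : ℚ) ≠ 0 := by exact_mod_cast h₁.ne_zero
  have h0₂ : (d₂ : ℚ) ≠ 0 := by exact_mod_cast h₂.ne_zero
  have h1 : sqClass ((d₁ : ℚ) * d₂) = 1 := by rw [sqClass_mul h0₁ h0₂, he, Affine.SqUnits.mul_self]
  obtain ⟨u, hu⟩ := (sqClass_eq_one_iff (mul_ne_zero h0₁ h0₂)).mp h1
  obtain ⟨m, hm⟩ : IsSquare (d₁ * d₂) := by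
    rw [← Rat.isSquare_intCast_iff]
    exact ⟨u, by push_cast; rw [hu, pow_two]⟩
  exact eq_of_squarefree_of_mul_eq_sq h₁ h₂ (m := m) (by rw [hm, pow_two])

omit [Field K] [NumberField K] in
/-- `c·t²` and `c` have the same square class (`t ≠ 0`, `c ≠ 0`). [folklore] -/
private theorem sqClass_mul_sq_eq_pOne {c t : ℚ} (hc : c ≠ 0) (ht : t ≠ 0) : sqClass (c * t ^ 2) = sqClass c := by
  rw [sqClass_mul hc (pow_ne_zero 2 ht), Affine.sqClass_sq, Affine.SqUnits.mul_one]

omit [Field K] [NumberField K] in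
/-- The arithmetic of C7: `q ≠ 2, 7`, `p ≠ 2, 7`, `q ≠ p`; `−2qp`, `14qp`, `−14qp` are squarefree. [folklore] -/
private theorem cell_arith_negTwoQP_pOne (hq8 : q % 8 = 7) (hq7 : jacobiSym q 7 = -1) (hp8 : p % 8 = 1) :
    (q ≠ 2 ∧ q ≠ 7 ∧ p ≠ 2 ∧ p ≠ 7 ∧ q ≠ p) ∧ Squarefree (-2 * ((q : ℤ) * p)) ∧ Squarefree (14 * ((q : ℤ) * p)) ∧
      Squarefree (-14 * ((q : ℤ) * p)) := by
  have hq : q.Prime := Fact.out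
  have hp : p.Prime := Fact.out
  obtain ⟨hq2, hq7'⟩ := ne_two_and_ne_seven_of_jacobiSym hq7
  have hp2 : p ≠ 2 := by rintro rfl; norm_num at hp8
  have hp7' : p ≠ 7 := by rintro rfl; norm_num at hp8
  have hqp : q ≠ p := by rintro rfl; omega
  have h2q : Nat.Coprime 2 q := (Nat.coprime_primes Nat.prime_two hq).mpr (Ne.symm hq2)
  have h2p : Nat.Coprime 2 p := (Nat.coprime_primes Nat.prime_two hp).mpr (Ne.symm hp2)
  have h7q : Nat.Coprime 7 q := (Nat.coprime_primes (by norm_num) hq).mpr (Ne.symm hq7')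
  have h7p : Nat.Coprime 7 p := (Nat.coprime_primes (by norm_num) hp).mpr (Ne.symm hp7')
  have hqp' : Nat.Coprime q p := (Nat.coprime_primes hq hp).mpr hqp
  have hqpS : Squarefree (q * p) := (Nat.squarefree_mul hqp').mpr ⟨hq.squarefree, hp.squarefree⟩
  have h2 : Squarefree (((2 * (q * p) : ℕ) : ℤ)) := Int.squarefree_natCast.mpr
    ((Nat.squarefree_mul (Nat.Coprime.mul_right h2q h2p)).mpr ⟨Nat.squarefree_two, hqpS⟩)
  have h14' : Squarefree (14 : ℕ) := by
    rw [show (14 : ℕ) = 2 * 7 by norm_num]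
    exact (Nat.squarefree_mul (by norm_num)).mpr ⟨Nat.squarefree_two, (by norm_num : Nat.Prime 7).squarefree⟩
  have h14 : Squarefree (((14 * (q * p) : ℕ) : ℤ)) := by
    refine Int.squarefree_natCast.mpr ((Nat.squarefree_mul ?_).mpr ⟨h14', hqpS⟩)
    rw [show (14 : ℕ) = 2 * 7 by norm_num]
    exact Nat.Coprime.mul_left (Nat.Coprime.mul_right h2q h2p) (Nat.Coprime.mul_right h7q h7p)
  refine ⟨⟨hq2, hq7', hp2, hp7', hqp⟩, h2.squarefree_of_dvd ⟨-1, by push_cast; ring⟩, by exact_mod_cast h14,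
    h14.squarefree_of_dvd ⟨-1, by push_cast; ring⟩⟩

/-- **A squarefree `c` with `[c] ∈ α(E(ℚ))` lies in `S ⊆ {1, 2, 7, 14}`** (C7's `E = ⟨0, −42qp, 0, 448q²p², 0⟩`; Literature
`range_xSqClass_subset_image_twoIsogenySelmerGroup`, F9a). [cite: SilvermanAEC2009, Prop. X.4.9] -/
theorem mem_of_xSqClass_eq_sqClass_twoPrimesTwist_pOne (hq8 : q % 8 = 7) (hq7 : jacobiSym q 7 = -1) (hp4 : p % 4 = 1)
    (hp7 : legendreSym p (-7) = 1) (hpq : jacobiSym p q = -1)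
    [(⟨0, ((-42 * ((q : ℤ) * p) : ℤ) : ℚ), 0, ((448 * ((q : ℤ) * p) ^ 2 : ℤ) : ℚ), 0⟩ : WeierstrassCurve ℚ).IsElliptic]
    (P : (⟨0, ((-42 * ((q : ℤ) * p) : ℤ) : ℚ), 0, ((448 * ((q : ℤ) * p) ^ 2 : ℤ) : ℚ), 0⟩ : WeierstrassCurve ℚ).toAffine.Point)
    {c : ℤ} (hc : Squarefree c)
    (h : (⟨0, ((-42 * ((q : ℤ) * p) : ℤ) : ℚ), 0, ((448 * ((q : ℤ) * p) ^ 2 : ℤ) : ℚ), 0⟩ : WeierstrassCurve ℚ).xSqClass P = sqClass (c : ℚ)) :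
    c = 1 ∨ c = 2 ∨ c = 7 ∨ c = 14 := by
  have hq : q.Prime := Fact.out
  have hp : p.Prime := Fact.out
  have hab := hab_inertTwoTwist (m := q * p) (Nat.mul_pos hq.pos hp.pos)
  push_cast at hab
  have hsub := range_xSqClass_subset_image_twoIsogenySelmerGroup hab
  have hmem := hsub ⟨P, rfl⟩
  rw [Finset.coe_image] at hmem
  obtain ⟨d₁, hd₁, hd₁c⟩ := hmem
  rw [Finset.mem_coe] at hd₁
  have hd₁' := twoIsogenySelmerGroup_twoPrimesTwist_subset_pOne hq8 hq7 hp4 hp7 hpq hd₁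
  have hsqf : Squarefree d₁ := ((mem_twoIsogenySelmerGroup_iff (left_ne_zero_of_mul hab)).mp hd₁).1
  have heq : d₁ = c := eq_of_squarefree_of_sqClass_intCast_eq_pOne hsqf hc (hd₁c.trans h)
  subst heq
  simpa using hd₁'

/-- **A squarefree `c` with `[c] ∈ α′(E′(ℚ))` lies in `S′ ⊆ {1, −7, −qp, 7qp}`** (C7; F9b). [cite: SilvermanAEC2009, Prop. X.4.9] -/
theorem mem_of_xSqClass_codomain_eq_sqClass_twoPrimesTwist_pOne (hq8 : q % 8 = 7) (hq7 : jacobiSym q 7 = -1) (hp8 : p % 8 = 1)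
    (hp7 : legendreSym p (-7) = 1) (hβ : ∃ x : ZMod p, x ^ 4 = -7) (hpq : jacobiSym p q = -1)
    [(⟨0, ((-42 * ((q : ℤ) * p) : ℤ) : ℚ), 0, ((448 * ((q : ℤ) * p) ^ 2 : ℤ) : ℚ), 0⟩ : WeierstrassCurve ℚ).IsElliptic]
    (P : (⟨0, ((-42 * ((q : ℤ) * p) : ℤ) : ℚ), 0, ((448 * ((q : ℤ) * p) ^ 2 : ℤ) : ℚ), 0⟩ :
      WeierstrassCurve ℚ).twoIsogenyCodomain.toAffine.Point)
    {c : ℤ} (hc : Squarefree c)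
    (h : (⟨0, ((-42 * ((q : ℤ) * p) : ℤ) : ℚ), 0, ((448 * ((q : ℤ) * p) ^ 2 : ℤ) : ℚ), 0⟩ :
      WeierstrassCurve ℚ).twoIsogenyCodomain.xSqClass P = sqClass (c : ℚ)) :
    c = 1 ∨ c = -7 ∨ c = -((q : ℤ) * p) ∨ c = 7 * ((q : ℤ) * p) := by
  have hq : q.Prime := Fact.out
  have hp : p.Prime := Fact.out
  have hq0 : (q : ℤ) ≠ 0 := by exact_mod_cast hq.ne_zero
  have hp0 : (p : ℤ) ≠ 0 := by exact_mod_cast hp.ne_zero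
  have hA : (-2 * (-42 * ((q : ℤ) * p))) = 84 * ((q : ℤ) * p) := by ring
  have hB : ((-42 * ((q : ℤ) * p)) ^ 2 - 4 * (448 * ((q : ℤ) * p) ^ 2)) = -28 * ((q : ℤ) * p) ^ 2 := by ring
  have hb : (-28 * ((q : ℤ) * p) ^ 2 : ℤ) ≠ 0 := mul_ne_zero (by norm_num) (pow_ne_zero 2 (mul_ne_zero hq0 hp0))
  have hab' : ((-42 * ((q : ℤ) * p)) ^ 2 - 4 * (448 * ((q : ℤ) * p) ^ 2)) *
      ((-2 * (-42 * ((q : ℤ) * p))) ^ 2 - 4 * ((-42 * ((q : ℤ) * p)) ^ 2 - 4 * (448 * ((q : ℤ) * p) ^ 2))) ≠ 0 := by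
    rw [hA, hB]
    refine mul_ne_zero hb ?_
    rw [show (84 * ((q : ℤ) * p)) ^ 2 - 4 * (-28 * ((q : ℤ) * p) ^ 2) = 7168 * ((q : ℤ) * p) ^ 2 by ring]
    exact mul_ne_zero (by norm_num) (pow_ne_zero 2 (mul_ne_zero hq0 hp0))
  have hsub := range_xSqClass_subset_image_twoIsogenySelmerGroup hab'
  rw [← twoIsogenyCodomain_mk_intCast] at hsub
  have hmem := hsub ⟨P, rfl⟩
  rw [Finset.coe_image] at hmem
  obtain ⟨d₁, hd₁, hd₁c⟩ := hmem
  rw [Finset.mem_coe] at hd₁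
  have hd₁S : d₁ ∈ twoIsogenySelmerGroup' (-42 * ((q : ℤ) * p)) (448 * ((q : ℤ) * p) ^ 2) := by
    rw [twoIsogenySelmerGroup'_eq]; exact hd₁
  have hd₁' := twoIsogenySelmerGroup'_twoPrimesTwist_subset_pOne hq8 hq7 hp8 hp7 hβ hpq hd₁S
  rw [hA, hB, mem_twoIsogenySelmerGroup_iff hb] at hd₁
  have heq : d₁ = c := eq_of_squarefree_of_sqClass_intCast_eq_pOne hd₁.1 hc (hd₁c.trans h)
  subst heq
  simpa using hd₁'

/-- **THE HALVABILITY VALUE IS `k = 1` ON THE TWO-TORSION MODEL, cell C7.** For `q ≡ 7 (8)` prime with `(q/7) = −1`, `p ≡ 1 (8)` prime with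
`(−7/p) = 1`, `−7` a fourth power mod `p`, `(p/q) = −1`, `K` imaginary quadratic with `d_K = −8qp`, and `E = ⟨0, −42qp, 0, 448q²p², 0⟩` of rank
one: NOT every `y ∈ E(ℚ)` is divisible by `2` in `E(K)` up to torsion (§1's two-sided count; the excluded classes `[−2qp]`, `[−14qp]` (E-side)
and `[−2qp]`, `[14qp]` (E′-side) are outside `S` resp. `S′`). [cite: SilvermanTate2015, §3.5–3.6] [cite: SilvermanAEC2009, Prop. X.4.9 and Exercise 10.16] -/
theorem not_forall_halvable_twoTorsionModel_twoPrimesTwist_pOne (hK : IsImaginaryQuadratic K) (hq8 : q % 8 = 7)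
    (hq7 : jacobiSym q 7 = -1) (hp8 : p % 8 = 1) (hp7 : legendreSym p (-7) = 1) (hβ : ∃ x : ZMod p, x ^ 4 = -7)
    (hpq : jacobiSym p q = -1) (hdK : NumberField.discr K = -(8 * (q : ℤ) * p))
    [(⟨0, ((-42 * ((q : ℤ) * p) : ℤ) : ℚ), 0, ((448 * ((q : ℤ) * p) ^ 2 : ℤ) : ℚ), 0⟩ : WeierstrassCurve ℚ).IsElliptic]
    (hr : (⟨0, ((-42 * ((q : ℤ) * p) : ℤ) : ℚ), 0, ((448 * ((q : ℤ) * p) ^ 2 : ℤ) : ℚ), 0⟩ :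
      WeierstrassCurve ℚ).mordellWeilRank = 1) :
    ¬ ∀ y : (⟨0, ((-42 * ((q : ℤ) * p) : ℤ) : ℚ), 0, ((448 * ((q : ℤ) * p) ^ 2 : ℤ) : ℚ), 0⟩ : WeierstrassCurve ℚ).toAffine.Point,
      ∃ Q : ((⟨0, ((-42 * ((q : ℤ) * p) : ℤ) : ℚ), 0, ((448 * ((q : ℤ) * p) ^ 2 : ℤ) : ℚ), 0⟩ :
        WeierstrassCurve ℚ).baseChange K).toAffine.Point,
        incl K (⟨0, ((-42 * ((q : ℤ) * p) : ℤ) : ℚ), 0, ((448 * ((q : ℤ) * p) ^ 2 : ℤ) : ℚ), 0⟩ : WeierstrassCurve ℚ) y -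
          (2 : ℤ) • Q ∈ AddCommGroup.torsion _ := by
  have hq : q.Prime := Fact.out
  have hp : p.Prime := Fact.out
  obtain ⟨⟨hq2, hq7', hp2, hp7', hqp⟩, hsqf2, hsqf14, hsqfm14⟩ := cell_arith_negTwoQP_pOne (q := q) (p := p) hq8 hq7 hp8
  obtain ⟨h7, h7'⟩ := not_isSquare_seven_negEightTwoPrimesField hK hq hp hq7' hp7' hdK
  have hqQ : (q : ℚ) ≠ 0 := by exact_mod_cast hq.ne_zero
  have hpQ : (p : ℚ) ≠ 0 := by exact_mod_cast hp.ne_zero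
  have hqK : (q : K) ≠ 0 := by exact_mod_cast hq.ne_zero
  have hpK : (p : K) ≠ 0 := by exact_mod_cast hp.ne_zero
  have hN : 0 < (q : ℤ) * p := by have := Nat.mul_pos hq.pos hp.pos; exact_mod_cast this
  have hdQ : ((NumberField.discr K : ℤ) : ℚ) = -(8 * (q : ℚ) * p) := by rw [hdK]; push_cast; ring
  have hsq1 : sqClass ((NumberField.discr K : ℤ) : ℚ) = sqClass (((-2 * ((q : ℤ) * p) : ℤ)) : ℚ) := by
    rw [hdQ, show (-(8 * (q : ℚ) * p)) = (((-2 * ((q : ℤ) * p) : ℤ)) : ℚ) * 2 ^ 2 by push_cast; ring]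
    exact sqClass_mul_sq_eq_pOne (by push_cast; exact mul_ne_zero (by norm_num) (mul_ne_zero hqQ hpQ)) two_ne_zero
  refine not_forall_halvable_of_descent_twoSided hK _ ?_ ?_ (fun P ↦ ⟨?_, ?_⟩) (fun P ↦ ⟨?_, ?_⟩) hr
  · -- `a² − 4b = −7·(2qp)² ∉ K²`
    rintro ⟨r, hr'⟩
    simp only [WeierstrassCurve.baseChange, WeierstrassCurve.map_a₂, WeierstrassCurve.map_a₄, eq_ratCast] at hr'
    push_cast at hr'
    exact h7 (isSquare_of_sq_mul (k := 2 * ((q : K) * p)) (mul_ne_zero two_ne_zero (mul_ne_zero hqK hpK)) (r := r)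
      (by linear_combination hr'.symm))
  · -- `b = 7·(8qp)² ∉ K²`
    rintro ⟨r, hr'⟩
    simp only [WeierstrassCurve.baseChange, WeierstrassCurve.map_a₄, eq_ratCast] at hr'
    push_cast at hr'
    exact h7' (isSquare_of_sq_mul (k := 8 * ((q : K) * p)) (mul_ne_zero (by norm_num) (mul_ne_zero hqK hpK)) (r := r)
      (by linear_combination hr'.symm))
  · -- E-side: `[d_K] = [−2qp] ∉ S`
    rw [hsq1]
    intro h
    rcases mem_of_xSqClass_eq_sqClass_twoPrimesTwist_pOne hq8 hq7 (by omega) hp7 hpq P hsqf2 h with h1 | h1 | h1 | h1 <;> omega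
  · -- E-side: `[b·d_K] = [−14qp] ∉ S`
    have hsq2 : sqClass ((⟨0, ((-42 * ((q : ℤ) * p) : ℤ) : ℚ), 0, ((448 * ((q : ℤ) * p) ^ 2 : ℤ) : ℚ), 0⟩ : WeierstrassCurve ℚ).a₄ *
        ((NumberField.discr K : ℤ) : ℚ)) = sqClass (((-14 * ((q : ℤ) * p) : ℤ)) : ℚ) := by
      rw [hdQ]
      push_cast
      rw [show (448 * ((q : ℚ) * p) ^ 2) * -(8 * (q : ℚ) * p) = (-14 * ((q : ℚ) * p)) * (16 * ((q : ℚ) * p)) ^ 2 by ring]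
      exact sqClass_mul_sq_eq_pOne (mul_ne_zero (by norm_num) (mul_ne_zero hqQ hpQ)) (mul_ne_zero (by norm_num) (mul_ne_zero hqQ hpQ))
    rw [hsq2]
    intro h
    rcases mem_of_xSqClass_eq_sqClass_twoPrimesTwist_pOne hq8 hq7 (by omega) hp7 hpq P hsqfm14 h with h1 | h1 | h1 | h1 <;> omega
  · -- E′-side: `[d_K] = [−2qp] ∉ S′`
    rw [hsq1]
    intro h
    rcases mem_of_xSqClass_codomain_eq_sqClass_twoPrimesTwist_pOne hq8 hq7 hp8 hp7 hβ hpq P hsqf2 h with h1 | h1 | h1 | h1 <;> omega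
  · -- E′-side: `[a′₄·d_K] = [14qp] ∉ S′`
    have hsq2 : sqClass ((⟨0, ((-42 * ((q : ℤ) * p) : ℤ) : ℚ), 0, ((448 * ((q : ℤ) * p) ^ 2 : ℤ) : ℚ), 0⟩ :
        WeierstrassCurve ℚ).twoIsogenyCodomain.a₄ * ((NumberField.discr K : ℤ) : ℚ)) = sqClass (((14 * ((q : ℤ) * p) : ℤ)) : ℚ) := by
      rw [twoIsogenyCodomain_a₄, hdQ]
      push_cast
      rw [show ((-42 * ((q : ℚ) * p)) ^ 2 - 4 * (448 * ((q : ℚ) * p) ^ 2)) * -(8 * (q : ℚ) * p) =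
        (14 * ((q : ℚ) * p)) * (4 * ((q : ℚ) * p)) ^ 2 by ring]
      exact sqClass_mul_sq_eq_pOne (mul_ne_zero (by norm_num) (mul_ne_zero hqQ hpQ)) (mul_ne_zero (by norm_num) (mul_ne_zero hqQ hpQ))
    rw [hsq2]
    intro h
    rcases mem_of_xSqClass_codomain_eq_sqClass_twoPrimesTwist_pOne hq8 hq7 hp8 hp7 hβ hpq P hsqf14 h with h1 | h1 | h1 | h1 <;> omega

/-- **THE HALVABILITY VALUE IS `k = 1` ON C7.** For `q ≡ 7 (8)` prime, `(q/7) = −1`; `p ≡ 1 (8)` prime, `(−7/p) = 1`, `−7` a fourth power mod `p`;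
`(p/q) = −1`; `K` imaginary quadratic with `d_K = −8qp`; ANY elliptic `W/ℚ` with `C • W = X₀(49)^{(−2qp)}` and `rank W(ℚ) = 1`: NOT every
`y ∈ W(ℚ)` is divisible by `2` in `W(K)` up to torsion (transport as T3-I-a). UNCONDITIONAL given rank one (on C7 the rank axis, F6b).
[cite: SilvermanTate2015, §3.5–3.6] [cite: SilvermanAEC2009, Prop. X.4.9 and Exercise 10.16] -/
theorem not_forall_halvable_twoPrimesTwist_pOne (hK : IsImaginaryQuadratic K) (hq8 : q % 8 = 7) (hq7 : jacobiSym q 7 = -1)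
    (hp8 : p % 8 = 1) (hp7 : legendreSym p (-7) = 1) (hβ : ∃ x : ZMod p, x ^ 4 = -7) (hpq : jacobiSym p q = -1)
    (hdK : NumberField.discr K = -(8 * (q : ℤ) * p))
    (W : WeierstrassCurve ℚ) [W.IsElliptic] (C₁ : VariableChange ℚ)
    (hC₁ : C₁ • W = cm7.quadraticTwist ((-2 * ((q : ℤ) * p) : ℤ) : ℚ)) (hr : W.mordellWeilRank = 1) :
    ¬ ∀ y : W.toAffine.Point, ∃ Q : (W.baseChange K).toAffine.Point,
        incl K W y - (2 : ℤ) • Q ∈ AddCommGroup.torsion (W.baseChange K).toAffine.Point := by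
  have hq : q.Prime := Fact.out
  have hp : p.Prime := Fact.out
  -- `C • W = E`
  have hCE := (smul_eq_twoTorsionModel_of_smul_eq_quadraticTwist (-2 * ((q : ℤ) * p)) W C₁ hC₁).trans
    (show (⟨0, ((21 * (-2 * ((q : ℤ) * p)) : ℤ) : ℚ), 0, ((112 * (-2 * ((q : ℤ) * p)) ^ 2 : ℤ) : ℚ), 0⟩ :
        WeierstrassCurve ℚ) = ⟨0, ((-42 * ((q : ℤ) * p) : ℤ) : ℚ), 0, ((448 * ((q : ℤ) * p) ^ 2 : ℤ) : ℚ), 0⟩ by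
      ext <;> push_cast <;> ring)
  set C : VariableChange ℚ := ⟨(Units.mk0 (2 : ℚ) two_ne_zero)⁻¹, 2 * ((-2 * ((q : ℤ) * p) : ℤ) : ℚ), 0, 0⟩ * C₁ with hC
  haveI hE : (⟨0, ((-42 * ((q : ℤ) * p) : ℤ) : ℚ), 0, ((448 * ((q : ℤ) * p) ^ 2 : ℤ) : ℚ), 0⟩ : WeierstrassCurve ℚ).IsElliptic := by
    rw [← hCE]; infer_instance
  -- rank transport
  have hrE : (⟨0, ((-42 * ((q : ℤ) * p) : ℤ) : ℚ), 0, ((448 * ((q : ℤ) * p) ^ 2 : ℤ) : ℚ), 0⟩ :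
      WeierstrassCurve ℚ).mordellWeilRank = 1 := by
    rw [← mordellWeilRank_congr hCE, ← hr]
    have h := mordellWeilRank_variableChange_holds W C
    unfold mordellWeilRank_variableChange at h
    convert h using 2
  intro hall
  refine not_forall_halvable_twoTorsionModel_twoPrimesTwist_pOne hK hq8 hq7 hp8 hp7 hβ hpq hdK hrE fun P ↦ ?_
  -- the rational point `y = C⁻¹ • P` of `W` and its hypothetical half `Q ∈ W(K)`
  set e₀ := (VariableChange.pointEquiv W C).trans (Affine.Point.congrEquiv hCE) with he₀
  obtain ⟨Q, hQ⟩ := hall (e₀.symm P)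
  -- push forward to `E(K)`
  set Φ := (VariableChange.pointEquivBaseChange W C K).trans
    (Affine.Point.congrEquiv (congrArg (fun V : WeierstrassCurve ℚ => V.baseChange K) hCE)) with hΦ
  have hΦy : Φ (incl K W (e₀.symm P)) = incl K _ P := by
    rw [hΦ, AddEquiv.trans_apply, pointEquivBaseChange_incl, congrEquiv_incl hCE]
    congr 1
    rw [he₀]
    simp only [AddEquiv.symm_trans_apply]
    rw [AddEquiv.apply_symm_apply, AddEquiv.apply_symm_apply]
  refine ⟨Φ Q, (AddCommGroup.mem_torsion _).mpr ?_⟩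
  rw [← hΦy, ← map_zsmul, ← map_sub]
  exact Φ.toAddMonoidHom.isOfFinAddOrder ((AddCommGroup.mem_torsion _).mp hQ)

end HalvabilityC7

end Summit.BirchSwinnertonDyer.BirchSwinnertonDyer.Theorems.GoldfeldGoodTwists

end
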